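import Literature.Analysis.FluidPDE.AncientWeakL3BackwardLiouvilleHolds
import Literature.Analysis.FluidPDE.TypeIAncientMild
import Literature.Analysis.FluidPDE.NewtonPotentialHolder
import Summits.NavierStokesRegularity.NavierStokesRegularity.Theorems.QuantisedSymmetryPolyhedralDssProfileExistsStubSmoothRepresentativeAe
import HarnessLib

/-!
# No large-scale null slice — crux stmt-NavierStokesRegularity-1404
  (`QuantisedSymmetry.PolyhedralDssProfileExists`), line polyhedral_cell,
  stub stub_noLargeScaleNullSlice (N17)

Registered necessary condition `stub_noLargeScaleNullSlice`
(`--supports stmt-NavierStokesRegularity-1404`): no slice of a Type-I ancient mild solution of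
3-D Navier–Stokes (duality form `IsAncientMildSolution 1 u`, measurable slices, `HasTypeIDecay C₀ u`)
is null at large scales — if at some `t₀ < 0` the Navier–Stokes blow-downs `λ u(t₀, λ·)` tend to
`0` in `𝒟'` as `λ → ∞`, then `u(t) = 0` a.e. for every `t ≤ t₀`. This is Albritton–Barker 2019,
Thm 4.1 (`ε = 0`), the TREE THEOREM `AlbrittonBarker2019_liouville_weakL3_backward_holds`, applied
on the crux's class.

Proof sketch.
* `stub_smoothRepresentative_ae`: a representative `V` in the Oseen gauge, `IsTypeIAncientMild C V`,
  `HasTypeIDecay C₀ V`, `V(t) = u(t)` a.e. for every `t < 0`.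
* The zoom hypothesis passes from `u(t₀)` to `V(t₀)`: for `λ > 0` the homothety `x ↦ λx`
  preserves Lebesgue-null sets (`Measure.quasiMeasurePreserving_smul`).
* Time-translate `v(t) = V(t − δ)`, `δ = −t₀/2` (`IsTypeIAncientMild.comp_sub_right`): `v` is
  continuous and bounded by `C/√δ` on `t < 0`, weakly divergence free, Oseen-mild with
  `heatExtension`, and `v(t₀/2) = V(t₀)`.
* Weak-`L³`: `s < ‖V(t, x)‖ ≤ C₀/(‖x‖ + √(−t))` forces `‖x‖ < C₀/s`, so
  `s³ · vol{s < |v(τ_k)|} ≤ C₀³ |B₁|` along `τ_k = −k − 1 → −∞`.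
* Heat bound (`sqrt_mul_norm_heatExtension_le_of_norm_le_div`): from `‖g(z)‖ ≤ C₀/‖z‖` alone,
  `√σ ‖e^{σΔ}g‖_∞ ≤ ((4π)^{-3/2} (3/2)|B₁| + 1) C₀`, splitting `∫ K_σ(y)|g(x − y)| dy` at
  `‖x − y‖ = √σ`: inside, `K_σ ≤ (4πσ)^{-3/2}` and `∫_{B_ρ} |z|⁻¹ dz = (3/2)|B₁| ρ²`
  (`NewtonPotentialHolder.lintegral_ball_norm_rpow_neg`); outside, `|g| ≤ C₀/√σ` and `∫ K_σ = 1`.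
* The tree theorem at final time `t₀/2` gives `v ≡ 0` for `t ≤ t₀/2`, i.e. `V(t) = 0` for
  `t ≤ t₀`; hence `u(t) = 0` a.e.
-/

noncomputable section

-- the summit namespace `…NavierStokesRegularity.NavierStokesRegularity…` is the tree convention (D-0017)
set_option linter.dupNamespace false

namespace Summit.NavierStokesRegularity.NavierStokesRegularity.Theorems.PolyhedralDssProfileExists.PolyhedralCell

open MeasureTheory Set Function Filter Topology Metric
open Literature.Analysis Literature.Analysis.FluidPDE
open scoped InnerProductSpace RealInnerProductSpace ENNReal

/-! ### The heat-kernel `Ḃ^{-1}_{∞,∞}` bound from the decay `|g| ≤ C₀/|z|` -/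

/-- **Heat-kernel bound from critical decay.** If `‖g z‖ ≤ C₀/‖z‖` off the origin (`0 ≤ C₀`),
then `√σ ‖e^{σΔ} g (x)‖ ≤ ((4π)^{-3/2} · (3/2)|B₁| + 1) C₀` for all `σ > 0`, `x ∈ ℝ³`: split
`∫ K_σ(y) |g(x − y)| dy` at `‖x − y‖ = √σ`; inside use `K_σ ≤ (4πσ)^{-3/2}` and
`∫_{B_ρ} |z|⁻¹ = (3/2)|B₁| ρ²`, outside `|g| ≤ C₀/√σ` and `∫ K_σ = 1`. [folklore] -/
theorem sqrt_mul_norm_heatExtension_le_of_norm_le_div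
    (g : EuclideanSpace ℝ (Fin 3) → EuclideanSpace ℝ (Fin 3)) {C₀ : ℝ} (hC₀ : 0 ≤ C₀)
    (hg : ∀ z, z ≠ 0 → ‖g z‖ ≤ C₀ / ‖z‖) {σ : ℝ} (hσ : 0 < σ) (x : EuclideanSpace ℝ (Fin 3)) :
    Real.sqrt σ * ‖UnboundedOperators.heatExtension g σ x‖ ≤
      ((4 * Real.pi) ^ (-(3 : ℝ) / 2) *
        (3 * (volume : Measure (EuclideanSpace ℝ (Fin 3))).real (ball 0 1) / 2) + 1) * C₀ := by
  set ρ : ℝ := Real.sqrt σ with hρ_def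
  have hρ : 0 < ρ := Real.sqrt_pos.2 hσ
  have hρ2 : ρ ^ 2 = σ := Real.sq_sqrt hσ.le
  set V₁ : ℝ := (volume : Measure (EuclideanSpace ℝ (Fin 3))).real (ball 0 1) with hV₁
  have hV₁0 : 0 ≤ V₁ := measureReal_nonneg
  set c : ℝ := (4 * Real.pi * σ) ^ (-(3 : ℝ) / 2) with hc_def
  have hc0 : 0 ≤ c := by positivity
  -- the kernel sup bound on `ℝ³`
  have hsup : ∀ y : EuclideanSpace ℝ (Fin 3),
      ‖UnboundedOperators.heatKernel σ y‖ₑ ≤ ENNReal.ofReal c := fun y => by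
    have h := UnboundedOperators.heatKernel_le hσ y
    rw [finrank_euclideanSpace_fin, Nat.cast_ofNat] at h
    rw [Real.enorm_eq_ofReal (UnboundedOperators.heatKernel_pos hσ y).le]
    exact ENNReal.ofReal_le_ofReal h
  -- pointwise bound of `g` in `ℝ≥0∞`, off the origin
  have hgz : ∀ z : EuclideanSpace ℝ (Fin 3), z ≠ 0 →
      ‖g z‖ₑ ≤ ENNReal.ofReal C₀ * ENNReal.ofReal (‖z‖ ^ (-(1 : ℝ))) := fun z hz => by
    rw [← ofReal_norm, ← ENNReal.ofReal_mul hC₀, Real.rpow_neg_one, ← div_eq_mul_inv]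
    exact ENNReal.ofReal_le_ofReal (hg z hz)
  -- (1) the pointwise convolution bound
  have h1 : ‖UnboundedOperators.heatExtension g σ x‖ₑ ≤
      ∫⁻ y, ‖UnboundedOperators.heatKernel σ y‖ₑ * ‖g (x - y)‖ₑ :=
    UnboundedOperators.enorm_convolution_lsmul_le _ _ _
  -- (2) inside the ball `B(x, ρ)`
  have hin : ∫⁻ y in ball x ρ, ‖UnboundedOperators.heatKernel σ y‖ₑ * ‖g (x - y)‖ₑ ≤
      ENNReal.ofReal c * (ENNReal.ofReal C₀ * ENNReal.ofReal (3 * V₁ * (σ / 2))) := by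
    have hae : ∀ᵐ z ∂((volume : Measure (EuclideanSpace ℝ (Fin 3))).restrict (ball 0 ρ)),
        z ≠ (0 : EuclideanSpace ℝ (Fin 3)) :=
      ae_restrict_of_ae (measure_eq_zero_iff_ae_notMem.1 (measure_singleton _))
    calc ∫⁻ y in ball x ρ, ‖UnboundedOperators.heatKernel σ y‖ₑ * ‖g (x - y)‖ₑ
        ≤ ∫⁻ y in ball x ρ, ENNReal.ofReal c * ‖g (x - y)‖ₑ :=
          lintegral_mono fun y => mul_le_mul_left (hsup y) _
      _ = ENNReal.ofReal c * ∫⁻ z in ball (0 : EuclideanSpace ℝ (Fin 3)) ρ, ‖g z‖ₑ := by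
          rw [lintegral_const_mul' _ _ ENNReal.ofReal_ne_top,
            NewtonPotentialHolder.lintegral_ball_comp_sub_left (fun z => ‖g z‖ₑ) x ρ]
      _ ≤ ENNReal.ofReal c * ∫⁻ z in ball (0 : EuclideanSpace ℝ (Fin 3)) ρ,
            ENNReal.ofReal C₀ * ENNReal.ofReal (‖z‖ ^ (-(1 : ℝ))) := by
          gcongr 1
          exact lintegral_mono_ae (hae.mono fun z hz => hgz z hz)
      _ = ENNReal.ofReal c * (ENNReal.ofReal C₀ * ENNReal.ofReal (3 * V₁ * (σ / 2))) := by
          rw [lintegral_const_mul' _ _ ENNReal.ofReal_ne_top,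
            NewtonPotentialHolder.lintegral_ball_norm_rpow_neg (by norm_num) hρ,
            show (3 : ℝ) - 1 = 2 by norm_num, Real.rpow_two, hρ2]
  -- (3) outside the ball: `|g(x - y)| ≤ C₀/ρ` and `∫ K_σ ≤ 1`
  have hout : ∫⁻ y in (ball x ρ)ᶜ, ‖UnboundedOperators.heatKernel σ y‖ₑ * ‖g (x - y)‖ₑ ≤
      ENNReal.ofReal (C₀ / ρ) := by
    have hpt : ∀ y ∈ (ball x ρ)ᶜ, ‖g (x - y)‖ₑ ≤ ENNReal.ofReal (C₀ / ρ) := fun y hy => by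
      have hxy : ρ ≤ ‖x - y‖ := by
        rw [← dist_eq_norm]; exact le_of_not_gt (fun h => hy (mem_ball'.2 h))
      have hne : x - y ≠ 0 := norm_pos_iff.1 (hρ.trans_le hxy)
      rw [← ofReal_norm]
      exact ENNReal.ofReal_le_ofReal
        ((hg _ hne).trans (div_le_div_of_nonneg_left hC₀ hρ hxy))
    calc ∫⁻ y in (ball x ρ)ᶜ, ‖UnboundedOperators.heatKernel σ y‖ₑ * ‖g (x - y)‖ₑ
        ≤ ∫⁻ y in (ball x ρ)ᶜ, ‖UnboundedOperators.heatKernel σ y‖ₑ * ENNReal.ofReal (C₀ / ρ) :=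
          setLIntegral_mono' measurableSet_ball.compl fun y hy => mul_le_mul_right (hpt y hy) _
      _ ≤ ∫⁻ y, ‖UnboundedOperators.heatKernel σ y‖ₑ * ENNReal.ofReal (C₀ / ρ) :=
          setLIntegral_le_lintegral _ _
      _ = ENNReal.ofReal (C₀ / ρ) := by
          rw [lintegral_mul_const' _ _ ENNReal.ofReal_ne_top,
            UnboundedOperators.lintegral_enorm_heatKernel hσ, one_mul]
  -- (4) assemble in `ℝ≥0∞`, then pass to `ℝ`
  have htot : ‖UnboundedOperators.heatExtension g σ x‖ₑ ≤
      ENNReal.ofReal (c * (C₀ * (3 * V₁ * (σ / 2))) + C₀ / ρ) := by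
    refine h1.trans ?_
    rw [← lintegral_add_compl _ (measurableSet_ball (x := x) (ε := ρ)),
      ENNReal.ofReal_add (by positivity) (by positivity), ENNReal.ofReal_mul hc0,
      ENNReal.ofReal_mul hC₀]
    exact add_le_add hin hout
  rw [← ofReal_norm, ENNReal.ofReal_le_ofReal_iff (by positivity)] at htot
  -- the constant: `√σ · (4πσ)^{-3/2} · σ = (4π)^{-3/2}`
  have hconst : ρ * c * σ = (4 * Real.pi) ^ (-(3 : ℝ) / 2) := by
    have e1 : c = (4 * Real.pi) ^ (-(3 : ℝ) / 2) * σ ^ (-(3 : ℝ) / 2) :=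
      Real.mul_rpow (by positivity) hσ.le
    have e2 : ρ * σ ^ (-(3 : ℝ) / 2) * σ = 1 := by
      rw [hρ_def, Real.sqrt_eq_rpow, ← Real.rpow_add hσ, ← Real.rpow_add_one hσ.ne']
      norm_num
    calc ρ * c * σ = (ρ * σ ^ (-(3 : ℝ) / 2) * σ) * (4 * Real.pi) ^ (-(3 : ℝ) / 2) := by
          rw [e1]; ring
      _ = _ := by rw [e2, one_mul]
  calc ρ * ‖UnboundedOperators.heatExtension g σ x‖
      ≤ ρ * (c * (C₀ * (3 * V₁ * (σ / 2))) + C₀ / ρ) := mul_le_mul_of_nonneg_left htot hρ.le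
    _ = (ρ * c * σ) * (3 * V₁ / 2) * C₀ + C₀ := by
        rw [mul_add, mul_div_cancel₀ _ hρ.ne']; ring
    _ = ((4 * Real.pi) ^ (-(3 : ℝ) / 2) * (3 * V₁ / 2) + 1) * C₀ := by rw [hconst]; ring

/-! ### The stub -/

/-- **stub_noLargeScaleNullSlice** (no slice of a Type-I ancient mild solution is null at large
scales; Albritton–Barker 2019, Thm 4.1 with `ε = 0`, applied on the crux's class). If `u` is a
Type-I ancient mild solution of 3-D Navier–Stokes in the duality form (`IsAncientMildSolution 1 u`,
measurable slices, `HasTypeIDecay C₀ u`) and at some `t₀ < 0` the Navier–Stokes blow-downs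
`λ u(t₀, λ·)` tend to `0` in `𝒟'` as `λ → ∞`, then `u(t) = 0` a.e. for every `t ≤ t₀`. Proof:
smooth Oseen-gauge representative `V` (`stub_smoothRepresentative_ae`); transfer of the zoom
hypothesis along the null-set preserving homotheties; the time translate `V(· + t₀/2)` is in the
bounded Oseen class of the tree theorem `AlbrittonBarker2019_liouville_weakL3_backward_holds`, with
the weak-`L³` bound `s³ vol{s < |V(τ)|} ≤ C₀³|B₁|` from the space–time Type-I bound and the
`Ḃ^{-1}_{∞,∞}` bound `sqrt_mul_norm_heatExtension_le_of_norm_le_div` of the final slice. [cite: AlbrittonBarker2019, Thm 4.1 (arXiv:1811.00502 §4 p. 9)] -/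
theorem stub_noLargeScaleNullSlice :
    ∀ (u : ℝ → EuclideanSpace ℝ (Fin 3) → EuclideanSpace ℝ (Fin 3)) (C₀ : ℝ),
      IsAncientMildSolution 1 u → (∀ t < 0, AEStronglyMeasurable (u t) volume) → HasTypeIDecay C₀ u →
      ∀ t₀ < 0,
        (∀ φ : EuclideanSpace ℝ (Fin 3) → EuclideanSpace ℝ (Fin 3),
          Literature.Analysis.FunctionSpaces.IsTestFunctionOn
            (⊤ : TopologicalSpace.Opens (EuclideanSpace ℝ (Fin 3))) φ →
          Tendsto (fun lam : ℝ => ∫ x, ⟪lam • u t₀ (lam • x), φ x⟫_ℝ) atTop (𝓝 0)) →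
        ∀ t ≤ t₀, u t =ᵐ[volume] 0 := by
  intro u C₀ hu hmeas hdec t₀ ht₀ hzoom t ht
  have hC₀ : 0 ≤ C₀ := by simpa using (norm_nonneg _).trans (hdec (-1) (by norm_num) 0)
  -- ## Step 1: the smooth Oseen-gauge representative
  obtain ⟨V, C, hT, hdecV, haeq, -⟩ := stub_smoothRepresentative_ae u C₀ hu hmeas hdec
  -- ## Step 2: time translation `v(s) = V(s - δ)`, `δ = -t₀/2`
  set δ : ℝ := -t₀ / 2 with hδ_def
  have hδ : 0 < δ := by rw [hδ_def]; linarith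
  have hhalf : t₀ / 2 - δ = t₀ := by rw [hδ_def]; ring
  have ht₀2 : t₀ / 2 < 0 := by linarith
  have hTv : IsTypeIAncientMild C (fun s => V (s - δ)) := hT.comp_sub_right hδ.le
  -- boundedness on the open past
  have hbdd : ∃ K : ℝ, ∀ s < 0, ∀ x, ‖(fun s => V (s - δ)) s x‖ ≤ K :=
    ⟨C / Real.sqrt δ, fun s hs x => (hT.norm_le (by linarith) x).trans
      (div_le_div_of_nonneg_left hT.nonneg (Real.sqrt_pos.2 hδ) (Real.sqrt_le_sqrt (by linarith)))⟩
  -- ## Step 3: the uniform weak-`L³` bound along `τ_k = -k - 1`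
  have hweak : ∃ (τ : ℕ → ℝ) (M : ℝ≥0∞), M < ∞ ∧ Tendsto τ atTop atBot ∧ (∀ k, τ k < 0) ∧
      ∀ (k : ℕ) (s : ℝ), 0 < s → ENNReal.ofReal s ^ 3 *
        volume {x : EuclideanSpace ℝ (Fin 3) | s < ‖(fun s => V (s - δ)) (τ k) x‖} ≤ M := by
    refine ⟨fun k => -(k : ℝ) - 1,
      ENNReal.ofReal (C₀ ^ 3) * volume (ball (0 : EuclideanSpace ℝ (Fin 3)) 1),
      ENNReal.mul_lt_top ENNReal.ofReal_lt_top measure_ball_lt_top, ?_,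
      fun k => by linarith [(k.cast_nonneg : (0 : ℝ) ≤ k)], fun k s hs => ?_⟩
    · refine tendsto_atTop_atBot.2 fun b => ?_
      obtain ⟨n, hn⟩ := exists_nat_ge (-b)
      exact ⟨n, fun a ha => by
        have h : (n : ℝ) ≤ a := Nat.cast_le.2 ha
        linarith⟩
    · have hτ : -(k : ℝ) - 1 - δ < 0 := by linarith [(k.cast_nonneg : (0 : ℝ) ≤ k)]
      have hsub : {x : EuclideanSpace ℝ (Fin 3) | s < ‖V (-(k : ℝ) - 1 - δ) x‖} ⊆
          ball 0 (C₀ / s) := fun x hx => by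
        rw [mem_ball_zero_iff, lt_div_iff₀ hs]
        have hD : 0 < ‖x‖ + Real.sqrt (-(-(k : ℝ) - 1 - δ)) :=
          add_pos_of_nonneg_of_pos (norm_nonneg _) (Real.sqrt_pos.2 (neg_pos.2 hτ))
        have h2 : s < C₀ / (‖x‖ + Real.sqrt (-(-(k : ℝ) - 1 - δ))) :=
          lt_of_lt_of_le hx (hdecV _ hτ x)
        rw [lt_div_iff₀ hD] at h2
        nlinarith [Real.sqrt_nonneg (-(-(k : ℝ) - 1 - δ)), norm_nonneg x]
      calc ENNReal.ofReal s ^ 3 *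
            volume {x : EuclideanSpace ℝ (Fin 3) | s < ‖V (-(k : ℝ) - 1 - δ) x‖}
          ≤ ENNReal.ofReal s ^ 3 * volume (ball (0 : EuclideanSpace ℝ (Fin 3)) (C₀ / s)) := by
            gcongr
        _ = ENNReal.ofReal (C₀ ^ 3) * volume (ball (0 : EuclideanSpace ℝ (Fin 3)) 1) := by
            rw [Measure.addHaar_ball volume _ (by positivity : (0 : ℝ) ≤ C₀ / s),
              finrank_euclideanSpace_fin, ← mul_assoc, ← ENNReal.ofReal_pow hs.le,
              ← ENNReal.ofReal_mul (by positivity), ← mul_pow, mul_div_cancel₀ _ hs.ne']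
  -- ## Step 4: the `Ḃ^{-1}_{∞,∞}` heat bound of the final slice `v(t₀/2) = V(t₀)`
  have hgz : ∀ z : EuclideanSpace ℝ (Fin 3), z ≠ 0 → ‖V t₀ z‖ ≤ C₀ / ‖z‖ := fun z hz =>
    (hdecV t₀ ht₀ z).trans (div_le_div_of_nonneg_left hC₀ (norm_pos_iff.2 hz)
      (le_add_of_nonneg_right (Real.sqrt_nonneg _)))
  have hheat : ∃ A : ℝ, ∀ σ : ℝ, 0 < σ → ∀ x,
      Real.sqrt σ * ‖UnboundedOperators.heatExtension ((fun s => V (s - δ)) (t₀ / 2)) σ x‖ ≤ A := by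
    refine ⟨((4 * Real.pi) ^ (-(3 : ℝ) / 2) *
      (3 * (volume : Measure (EuclideanSpace ℝ (Fin 3))).real (ball 0 1) / 2) + 1) * C₀,
      fun σ hσ x => ?_⟩
    show Real.sqrt σ * ‖UnboundedOperators.heatExtension (V (t₀ / 2 - δ)) σ x‖ ≤ _
    rw [hhalf]
    exact sqrt_mul_norm_heatExtension_le_of_norm_le_div (V t₀) hC₀ hgz hσ x
  -- ## Step 5: the zoom hypothesis passes to the representative
  have hzoomV : ∀ φ : EuclideanSpace ℝ (Fin 3) → EuclideanSpace ℝ (Fin 3),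
      FunctionSpaces.IsTestFunctionOn (⊤ : TopologicalSpace.Opens (EuclideanSpace ℝ (Fin 3))) φ →
      Tendsto (fun lam : ℝ => ∫ x, ⟪lam • (fun s => V (s - δ)) (t₀ / 2) (lam • x), φ x⟫_ℝ)
        atTop (𝓝 0) := by
    intro φ hφ
    show Tendsto (fun lam : ℝ => ∫ x, ⟪lam • V (t₀ / 2 - δ) (lam • x), φ x⟫_ℝ) atTop (𝓝 0)
    rw [hhalf]
    refine (hzoom φ hφ).congr' ?_
    filter_upwards [eventually_gt_atTop (0 : ℝ)] with lam hlam
    refine integral_congr_ae ?_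
    have h2 : ∀ᵐ x ∂(volume : Measure (EuclideanSpace ℝ (Fin 3))),
        V t₀ (lam • x) = u t₀ (lam • x) :=
      (Measure.quasiMeasurePreserving_smul volume hlam.ne').ae (haeq t₀ ht₀)
    filter_upwards [h2] with x hx
    rw [hx]
  -- ## Step 6: the tree theorem (Albritton–Barker 2019, Thm 4.1, `ε = 0`)
  have key := AlbrittonBarker2019_liouville_weakL3_backward_holds hTv.continuousOn_uncurry hbdd
    (fun s hs => hTv.isWeaklyDivFree hs) (fun s s' hss' hs' x => hTv.mild_eq_heatExtension hss' hs' x)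
    hweak ht₀2 hheat hzoomV
  have hVt : ∀ x, V t x = 0 := fun x => by
    have h := key (t + δ) (by linarith) x
    simpa only [add_sub_cancel_right] using h
  filter_upwards [haeq t (by linarith)] with x hx
  rw [Pi.zero_apply, ← hx]
  exact hVt x

end Summit.NavierStokesRegularity.NavierStokesRegularity.Theorems.PolyhedralDssProfileExists.PolyhedralCell

end
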